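import Summits.AtomisticToContinuum.FouriersLaw.Theorems.VanishingNoiseTransferNoisyFourierOfKuboLimit
import Summits.AtomisticToContinuum.FouriersLaw.Theorems.VanishingNoiseTransferNoisyFourierAbelCorrectorExists
import Summits.AtomisticToContinuum.FouriersLaw.Theorems.VanishingNoiseTransferNoisyFourierAbelLimit
import Summits.AtomisticToContinuum.FouriersLaw.Theorems.VanishingNoiseTransferNoisyFourierAbelMonotone
import Literature.MathematicalPhysics.KineticTheory.VelocityFlipNoise
import HarnessLib.Audit

/-!
# Line `abel-kapitza-even-corrector` — crux `VanishingNoiseTransfer.NoisyFourier` (stmt-AtomisticToContinuum-11977), lead c5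

Skeleton of the line, RESHAPED by lead c5 (2026-08-17) from c4's `Lines/abel_kapitza_even_corrector.lean`.
As before the crux follows from the finite-volume Green–Kubo limit `(L−1)·G_L → κ > 0`
(`G_L = γ(1 − (γ/T²)⟨g_L, p_0² − T⟩_{μ_T})`, classical forward fields `g_L`) through the landed closer
`noisyFourier_of_kuboLimit` (c3, p127584), and that limit is proved here from registered stubs about CLASSICAL Abel
correctors `u_{L,s} ∈ C² ∩ L²(μ_T)`, `(s − L_{T,T} − εS)u = J_L := Σ_i j_i` (`s > 0`), in tree vocabulary only.

WHAT CHANGED (c5). The resolvent derivative of the Abel–Green–Kubo pairing `σ_L(s) := ∫ J_L u_{L,s} dμ_T` is a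
`Π`-twisted square, `σ_L(s') − σ_L(s) = (s' − s)⟨u_s, u_{s'}∘Π⟩` (landed `resolvent_identity`), and the `Π`-odd part
of a corrector is flip-charged, hence FREE: `⟨u, u∘Π⟩ ≥ −‖(1−P₀)u‖² ≥ −E(u)/4 ≥ −L M₁/(4ε²)`. So
`s ↦ σ_L(s) + C₀ L s` is non-decreasing uniformly in `L`, which is
one half of the Abel equicontinuity the Moore–Osgood transfer needs (STUB M, LANDED p135142). c4's two-sided pair {A5 Kapitza bound
uniformly in `s ∈ (0,1]`, A6b Abel transfer} is therefore replaced by {M (free), U (upper Abel modulus at `0⁺`)},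
U being strictly weaker than A5 (A5 ⇒ U by the landed A6b). `abel_mooreOsgood` is generalised accordingly
(`abel_mooreOsgood_oneSided`). Stubs now:

* A2 `stub_abelCorrectorExists` — LANDED p133524 (imported);
* A3 `stub_abelLimit` — LANDED p133374 (imported): `∫ J_L u_{L,s} → (L−1)²γ(T² − γ⟨g_L, p_0²−T⟩) = T²(L−1)·[(L−1)G_L]`;
* A4 `stub_fixedAbelThermodynamicLimit` — at fixed `s ∈ (0,1]`, `∫ J_L u_{L,s}/(L−1)` converges as `L → ∞`
  (OPEN; reduction to AbelRowLocality landed p133683);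
* M  `stub_abelMonotone` — one-sided Abel monotonicity — LANDED p135142 (+Aux1 p134923), imported (FREE, lead c5);
* U  `stub_upperAbelModulus` — upper Abel modulus at `0⁺` (OPEN; the Fourier-law core; held by the lead);
* A7 `stub_thomsonFloor` — `∫ J_L u_{L,s} ≥ c(L−1)` (`c > 0`) eventually in `L`, uniformly in `s ∈ (0,1]`
  (OPEN in print for flips alone, BO2011 §6.2; ⇐ HalfConservedWitnessFamily).

(c4's A6a `stub_flipSectorGap` p129956 and A6b `stub_abelTransfer` p133427 stay landed; A6a is consumed inside M.)
Composition (sorry-free): `abel_mooreOsgood_oneSided` + `kuboLimit_of_parts`; `NoisyFourier_of` concludes the crux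
BY NAME. Disproof.lean honoured: `γ > 0`, `ε > 0` enter every stub; only the limit of `(L−1)G_L` is claimed (no
pointwise-in-`N` law); no steady state, `δ`-limit or family occurs in any stub.
-/

noncomputable section

open MeasureTheory Filter Topology
open scoped BigOperators

namespace Summit.AtomisticToContinuum.FouriersLaw.Cruxes.NoisyFourier.AbelKapitzaEvenCorrector

open Literature.MathematicalPhysics.KineticTheory.HeatConduction
open Summit.AtomisticToContinuum.FouriersLaw.Theses.VanishingNoiseTransfer (NoisyFourier)
open Summit.AtomisticToContinuum.FouriersLaw.Theorems.SuperadditiveResistance.DeviceLiouville (kin)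

/-! ## Registered stubs (statements in tree vocabulary; `sorry` only here; A2 and A3 are imported, landed) -/

/-- STUB A4 — THERMODYNAMIC LIMIT AT FIXED ABEL PARAMETER: for `s ∈ (0,1]` and every family `u L` of classical
Abel correctors, `∫ J_L · u L dμ_{L,T} / (L−1)` converges as `L → ∞` (light-cone locality at time horizon `1/s`). -/
theorem stub_fixedAbelThermodynamicLimit :
    ∀ (ω₂ lam β γ T ε : ℝ), 0 < ω₂ → 0 < lam → 0 < β → 0 < γ → 0 < T → 0 < ε →
      ∀ s : ℝ, 0 < s → s ≤ 1 → ∀ u : (L : ℕ) → Literature.MathematicalPhysics.KineticTheory.HeatConduction.PhaseSpace L → ℝ,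
        (∀ L : ℕ, 2 ≤ L → ContDiff ℝ 2 (u L) ∧ MeasureTheory.MemLp (u L) 2 ((Literature.MathematicalPhysics.KineticTheory.HeatConduction.pinnedChain ω₂ lam β γ).gibbsMeasure L T) ∧
          ∀ x, (Literature.MathematicalPhysics.KineticTheory.HeatConduction.pinnedChain ω₂ lam β γ).flipGenerator L T T ε (u L) x =
            s * u L x - ∑ i : Fin L, (Literature.MathematicalPhysics.KineticTheory.HeatConduction.pinnedChain ω₂ lam β γ).bondCurrent L i x) →
        ∃ K : ℝ, Filter.Tendsto (fun L : ℕ => (MeasureTheory.integral ((Literature.MathematicalPhysics.KineticTheory.HeatConduction.pinnedChain ω₂ lam β γ).gibbsMeasure L T) (fun x => (∑ i : Fin L, (Literature.MathematicalPhysics.KineticTheory.HeatConduction.pinnedChain ω₂ lam β γ).bondCurrent L i x) * u L x)) / ((L : ℝ) - 1)) Filter.atTop (nhds K) := by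
  sorry

/-- STUB U — THE UPPER ABEL MODULUS AT `0⁺` (lead c5; the OPEN half of the Abel equicontinuity, replacing c4's
Kapitza bound A5 + Abel transfer A6b): for every `η > 0` there are `s₀ ∈ (0,1]` and `L₀` such that for all
`L ≥ max(L₀,2)`, all `0 < s ≤ s' ≤ s₀` and classical Abel correctors `u` at `s`, `u'` at `s'`,
`∫ J_L u' dμ_T − ∫ J_L u dμ_T ≤ η (L − 1)` — the Abel–Green–Kubo pairing per bond does not INCREASE by more than `η`
below `s₀`, eventually in `L`. Sufficient: c4's Kapitza bound `‖P₀u_s‖² ≤ M L` uniformly in `s ∈ (0,1]`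
(then `|∫ J u' − ∫ J u| ≤ C(L−1)|s'−s|`, landed `stub_abelTransfer`); or any `‖P₊u_s‖² ≤ L h(s)` with `h`
integrable at `0` (`(d/ds)∫ J u_s = ⟨u_s, u_s∘Π⟩ ≤ ‖P₊u_s‖²`), against the free `‖u_s‖² ≤ L M₁/(8εs)`. Content:
no slow (time `≫ 1/s₀`) storage share `s‖u_s‖²` of the Green–Kubo functional, uniformly in `L` — the Fourier-law
core (linear temperature profile up to `O(1)` contact layers). -/
theorem stub_upperAbelModulus :
    ∀ (ω₂ lam β γ T ε : ℝ), 0 < ω₂ → 0 < lam → 0 < β → 0 < γ → 0 < T → 0 < ε → ∀ η : ℝ, 0 < η → ∃ s₀ : ℝ, 0 < s₀ ∧ s₀ ≤ 1 ∧ ∃ L₀ : ℕ, ∀ (L : ℕ), L₀ ≤ L → 2 ≤ L → ∀ s s' : ℝ, 0 < s → s ≤ s' → s' ≤ s₀ → ∀ u u' : Literature.MathematicalPhysics.KineticTheory.HeatConduction.PhaseSpace L → ℝ, (ContDiff ℝ 2 u ∧ MeasureTheory.MemLp u 2 ((Literature.MathematicalPhysics.KineticTheory.HeatConduction.pinnedChain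 ω₂ lam β γ).gibbsMeasure L T) ∧ ∀ x, (Literature.MathematicalPhysics.KineticTheory.HeatConduction.pinnedChain ω₂ lam β γ).flipGenerator L T T ε u x = s * u x - ∑ i : Fin L, (Literature.MathematicalPhysics.KineticTheory.HeatConduction.pinnedChain ω₂ lam β γ).bondCurrent L i x) → (ContDiff ℝ 2 u' ∧ MeasureTheory.MemLp u' 2 ((Literature.MathematicalPhysics.KineticTheory.HeatConduction.pinnedChain ω₂ lam β γ).gibbsMeasure L T) ∧ ∀ x, (Literature.MathematicalPhysics.KineticTheory.HeatConduction.pinnedChain ω₂ lam β γ).flipGenerator L T T ε u' x = s' * u' x - ∑ i : Fin L, (Literature.MathematicalPhysics.KineticTheory.HeatConduction.pinnedChain ω₂ lam β γ).bondCurrent L i x) → MeasureTheory.integral ((Literature.MathematicalPhysics.KineticTheory.HeatConduction.pinnedChain ω₂ lam β γ).gibbsMeasure L T) (fun x => (∑ i : Fin L, (Literature.MathematicalPhysics.KineticTheory.HeatConduction.pinnedChain ω₂ lam β γ).bondCurrent L i x) * u' x) - MeasureTheory.integral ((Literature.MathematicalPhysics.KineticTheory.HeatConduction.pinnedChain ω₂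 lam β γ).gibbsMeasure L T) (fun x => (∑ i : Fin L, (Literature.MathematicalPhysics.KineticTheory.HeatConduction.pinnedChain ω₂ lam β γ).bondCurrent L i x) * u x) ≤ η * ((L : ℝ) - 1) := by
  sorry

/-- STUB A7 — THE THOMSON FLOOR (open in print for flips alone, BO2011 §6.2): the Green–Kubo pairing is
extensive from below, `c(L−1) ≤ ∫ J_L · u dμ_T` (`c > 0`), eventually in `L`, uniformly in `s ∈ (0,1]`. -/
theorem stub_thomsonFloor :
    ∀ (ω₂ lam β γ T ε : ℝ), 0 < ω₂ → 0 < lam → 0 < β → 0 < γ → 0 < T → 0 < ε →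
      ∃ c : ℝ, 0 < c ∧ ∃ L₀ : ℕ, ∀ (L : ℕ), L₀ ≤ L → 2 ≤ L → ∀ s : ℝ, 0 < s → s ≤ 1 →
        ∀ u : Literature.MathematicalPhysics.KineticTheory.HeatConduction.PhaseSpace L → ℝ,
          (ContDiff ℝ 2 u ∧ MeasureTheory.MemLp u 2 ((Literature.MathematicalPhysics.KineticTheory.HeatConduction.pinnedChain ω₂ lam β γ).gibbsMeasure L T) ∧
            ∀ x, (Literature.MathematicalPhysics.KineticTheory.HeatConduction.pinnedChain ω₂ lam β γ).flipGenerator L T T ε u x =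
              s * u x - ∑ i : Fin L, (Literature.MathematicalPhysics.KineticTheory.HeatConduction.pinnedChain ω₂ lam β γ).bondCurrent L i x) →
          c * ((L : ℝ) - 1) ≤ MeasureTheory.integral ((Literature.MathematicalPhysics.KineticTheory.HeatConduction.pinnedChain ω₂ lam β γ).gibbsMeasure L T) (fun x => (∑ i : Fin L, (Literature.MathematicalPhysics.KineticTheory.HeatConduction.pinnedChain ω₂ lam β γ).bondCurrent L i x) * u x) := by
  sorry

/-! ## Composition (sorry-free) -/

/-- **One-sided Abel–Moore–Osgood transfer** (pure real analysis, lead c5): if, eventually in `N`, the functions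
`K_N` satisfy the one-sided bound `K_N(s') − K_N(s) ≥ −C(s' − s)` (`0 < s ≤ s' ≤ 1`), admit for every `η > 0`
a scale `s₀` below which they increase by at most `η` (eventually in `N`), have Abel limits `K_N(0⁺) = D_N`,
converge in `N` at each fixed `s ∈ (0,1]`, and are bounded below by `c > 0`, then `D_N` converges to a positive
limit. (The two one-sided hypotheses replace the two-sided Lipschitz bound of c4's `abel_mooreOsgood`.) -/
theorem abel_mooreOsgood_oneSided (K : ℕ → ℝ → ℝ) (D : ℕ → ℝ) (C c : ℝ) (hc : 0 < c)
    (hmono : ∀ᶠ N in atTop, ∀ s s' : ℝ, 0 < s → s ≤ s' → s' ≤ 1 → -(C * (s' - s)) ≤ K N s' - K N s)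
    (hupper : ∀ η : ℝ, 0 < η → ∃ s₀ : ℝ, 0 < s₀ ∧ s₀ ≤ 1 ∧
      ∀ᶠ N in atTop, ∀ s s' : ℝ, 0 < s → s ≤ s' → s' ≤ s₀ → K N s' - K N s ≤ η)
    (habel : ∀ᶠ N in atTop, Tendsto (K N) (𝓝[>] 0) (𝓝 (D N)))
    (htl : ∀ s : ℝ, 0 < s → s ≤ 1 → ∃ Λ : ℝ, Tendsto (fun N => K N s) atTop (𝓝 Λ))
    (hfloor : ∀ᶠ N in atTop, ∀ s : ℝ, 0 < s → s ≤ 1 → c ≤ K N s) :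
    ∃ κ : ℝ, 0 < κ ∧ Tendsto D atTop (𝓝 κ) := by
  set C' : ℝ := max C 1 with hC'
  have hC'pos : 0 < C' := lt_of_lt_of_le one_pos (le_max_right _ _)
  have hCC' : C ≤ C' := le_max_left _ _
  haveI : (𝓝[>] (0 : ℝ)).NeBot := nhdsGT_neBot 0
  -- (a) lower semicontinuity at `0⁺`, FREE from the one-sided bound: `D N ≤ K N s + C' s`
  have hA : ∀ᶠ N in atTop, ∀ s : ℝ, 0 < s → s ≤ 1 → D N ≤ K N s + C' * s := by
    filter_upwards [hmono, habel] with N hm ha s hs hs1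
    have hev : ∀ᶠ s'' in 𝓝[>] (0 : ℝ), K N s'' ≤ K N s + C' * s := by
      have hmem : Set.Ioc (0 : ℝ) s ∈ 𝓝[>] (0 : ℝ) := Ioc_mem_nhdsGT hs
      filter_upwards [hmem] with s'' hs''
      have h := hm s'' s hs''.1 hs''.2 hs1
      have h2 : C * (s - s'') ≤ C' * s := by
        rcases le_or_gt 0 C with hC0 | hC0
        · calc C * (s - s'') ≤ C * s := mul_le_mul_of_nonneg_left (by linarith [hs''.1]) hC0
            _ ≤ C' * s := mul_le_mul_of_nonneg_right hCC' hs.le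
        · have : C * (s - s'') ≤ 0 := mul_nonpos_of_nonpos_of_nonneg hC0.le (by linarith [hs''.2])
          linarith [mul_pos hC'pos hs]
      linarith
    exact le_of_tendsto ha hev
  -- (b) upper semicontinuity at `0⁺` from `hupper`: for every `η > 0` a scale `s ∈ (0,1]` with
  --     `|D N - K N s| ≤ η` eventually in `N`
  have hB : ∀ η : ℝ, 0 < η → ∃ s : ℝ, 0 < s ∧ s ≤ 1 ∧ ∀ᶠ N in atTop, |D N - K N s| ≤ η := by
    intro η hη
    obtain ⟨s₀, hs₀, hs₀1, hup⟩ := hupper (η / 2) (by positivity)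
    set s : ℝ := min s₀ (η / (2 * C')) with hsdef
    have hs : 0 < s := lt_min hs₀ (by positivity)
    have hss₀ : s ≤ s₀ := min_le_left _ _
    have hs1 : s ≤ 1 := hss₀.trans hs₀1
    have hsC : C' * s ≤ η / 2 := by
      calc C' * s ≤ C' * (η / (2 * C')) := mul_le_mul_of_nonneg_left (min_le_right _ _) hC'pos.le
        _ = η / 2 := by field_simp
    refine ⟨s, hs, hs1, ?_⟩
    filter_upwards [hA, hup, habel] with N hAN hupN haN
    have h1 : D N - K N s ≤ η / 2 := by linarith [hAN s hs hs1]
    -- `K N s - D N ≤ η/2`: let `s'' → 0⁺` in `K N s - K N s'' ≤ η/2`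
    have hev : ∀ᶠ s'' in 𝓝[>] (0 : ℝ), K N s - η / 2 ≤ K N s'' := by
      have hmem : Set.Ioc (0 : ℝ) s ∈ 𝓝[>] (0 : ℝ) := Ioc_mem_nhdsGT hs
      filter_upwards [hmem] with s'' hs''
      have h := hupN s'' s hs''.1 hs''.2 hss₀
      linarith
    have h2 : K N s - η / 2 ≤ D N := ge_of_tendsto haN hev
    rw [abs_le]
    constructor <;> linarith
  -- (c) `D` is Cauchy, hence convergent
  have hcauchy : CauchySeq D := by
    refine Metric.cauchySeq_iff.2 fun η hη => ?_
    obtain ⟨s, hs, hs1, hBN⟩ := hB (η / 4) (by positivity)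
    obtain ⟨Λ, hΛ⟩ := htl s hs hs1
    have hΛ' : ∀ᶠ N in atTop, |K N s - Λ| < η / 4 := by
      have := (Metric.tendsto_nhds.mp hΛ) (η / 4) (by positivity)
      simpa only [Real.dist_eq] using this
    obtain ⟨N₁, hN₁⟩ := (hBN.and hΛ').exists_forall_of_atTop
    refine ⟨N₁, fun m hm n hn => ?_⟩
    rw [Real.dist_eq]
    have hm' := hN₁ m hm
    have hn' := hN₁ n hn
    have e1 : |D m - Λ| < η / 2 := by
      calc |D m - Λ| ≤ |D m - K m s| + |K m s - Λ| := abs_sub_le _ _ _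
        _ < η / 4 + η / 4 := by linarith [hm'.1, hm'.2]
        _ = η / 2 := by ring
    have e2 : |D n - Λ| < η / 2 := by
      calc |D n - Λ| ≤ |D n - K n s| + |K n s - Λ| := abs_sub_le _ _ _
        _ < η / 4 + η / 4 := by linarith [hn'.1, hn'.2]
        _ = η / 2 := by ring
    calc |D m - D n| ≤ |D m - Λ| + |Λ - D n| := abs_sub_le _ _ _
      _ = |D m - Λ| + |D n - Λ| := by rw [abs_sub_comm Λ (D n)]
      _ < η := by linarith
  obtain ⟨κ, hκ⟩ := cauchySeq_tendsto_of_complete hcauchy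
  -- (d) positivity from the floor
  have hκpos : 0 < κ := by
    obtain ⟨s, hs, hs1, hBN⟩ := hB (c / 2) (by positivity)
    have hev : ∀ᶠ N in atTop, c / 2 ≤ D N := by
      filter_upwards [hBN, hfloor] with N hN hfN
      have h1 := hfN s hs hs1
      have h2 := (abs_le.mp hN).1
      linarith
    have := ge_of_tendsto hκ hev
    linarith
  exact ⟨κ, hκpos, hκ⟩

/-- **The line, composed** (sorry-free): the registered stubs give the finite-volume Green–Kubo limit of the flip
chain in exactly the form consumed by the landed closer `noisyFourier_of_kuboLimit`: for all parameters, `T, ε > 0`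
there is `κ > 0` such that `(L−1)·γ(1 − (γ/T²)∫ g_L (p_0² − T) dμ_T) → κ` for every family of classical forward
fields `g`. Proof: choose classical Abel correctors `u_{L,s}` (A2, landed) and set
`K_L(s) := ∫ J_L u_{L,s} dμ_T /(T²(L−1))`; by A3 (landed) `K_L(0⁺) = (L−1)G_L[g_L]` for EVERY forward field; by M
`K_L` is one-sidedly monotone with constant `2C₀/T²`, by U it has an `L`-uniform upper modulus at `0⁺`, by A4 it
converges at each fixed `s`, by A7 it is bounded below; `abel_mooreOsgood_oneSided` concludes. If for some `L ≥ 2`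
no forward field exists the `∀ g` clause is vacuous. -/
theorem kuboLimit_of_parts :
    ∀ (ω₂ lam β γ T ε : ℝ), 0 < ω₂ → 0 < lam → 0 < β → 0 < γ → 0 < T → 0 < ε → ∃ κ : ℝ, 0 < κ ∧
      ∀ g : (L : ℕ) → PhaseSpace L → ℝ,
        (∀ L : ℕ, 2 ≤ L → ContDiff ℝ 2 (g L) ∧ MemLp (g L) 2 ((pinnedChain ω₂ lam β γ).gibbsMeasure L T) ∧
          ∀ x, (pinnedChain ω₂ lam β γ).flipGenerator L T T ε (g L) x = -(kin L 0 x - T)) →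
        Tendsto (fun L : ℕ => ((L : ℝ) - 1) * (γ * (1 - γ / T ^ 2 *
          ∫ x, g L x * (kin L 0 x - T) ∂((pinnedChain ω₂ lam β γ).gibbsMeasure L T)))) atTop (𝓝 κ) := by
  intro ω₂ lam β γ T ε hω hl hβ hγ hT hε
  classical
  set P := pinnedChain ω₂ lam β γ with hP
  -- the forward-field predicate and the sequence of Kubo conductances
  set FF : (L : ℕ) → (PhaseSpace L → ℝ) → Prop := fun L g =>
    ContDiff ℝ 2 g ∧ MemLp g 2 (P.gibbsMeasure L T) ∧
      ∀ x, P.flipGenerator L T T ε g x = -(kin L 0 x - T) with hFF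
  set GK : (L : ℕ) → (PhaseSpace L → ℝ) → ℝ := fun L g =>
    ((L : ℝ) - 1) * (γ * (1 - γ / T ^ 2 * ∫ x, g x * (kin L 0 x - T) ∂(P.gibbsMeasure L T))) with hGK
  -- if some length carries no forward field, the claim is vacuous
  by_cases hex : ∀ L : ℕ, 2 ≤ L → ∃ g : PhaseSpace L → ℝ, FF L g
  swap
  · push Not at hex
    obtain ⟨L₀, hL₀, hno⟩ := hex
    refine ⟨1, one_pos, fun g hg => ?_⟩
    exact absurd (hg L₀ hL₀) (hno (g L₀))
  -- a reference family of forward fields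
  have hg0 : ∃ g0 : (L : ℕ) → PhaseSpace L → ℝ, ∀ L : ℕ, 2 ≤ L → FF L (g0 L) := by
    refine ⟨fun L => if h : 2 ≤ L then (hex L h).choose else fun _ => 0, fun L hL => ?_⟩
    simp only [dif_pos hL]
    exact (hex L hL).choose_spec
  obtain ⟨g0, hg0⟩ := hg0
  -- classical Abel correctors (A2, landed), junk `0` off `s > 0` or `L < 2`
  have hA2 := stub_abelCorrectorExists ω₂ lam β γ T ε hω hl hβ hγ hT hε
  set uc : (L : ℕ) → ℝ → PhaseSpace L → ℝ := fun L s =>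
    if h : 2 ≤ L ∧ 0 < s then (hA2 L h.1 s h.2).choose else fun _ => 0 with hucdef
  have huc : ∀ (L : ℕ), 2 ≤ L → ∀ s : ℝ, 0 < s →
      ContDiff ℝ 2 (uc L s) ∧ MemLp (uc L s) 2 (P.gibbsMeasure L T) ∧
        ∀ x, P.flipGenerator L T T ε (uc L s) x = s * uc L s x - ∑ i : Fin L, P.bondCurrent L i x := by
    intro L hL s hs
    have e : uc L s = (hA2 L hL s hs).choose := by simp only [hucdef, dif_pos (And.intro hL hs)]
    rw [e]
    exact (hA2 L hL s hs).choose_spec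
  -- the Abel-regularised per-bond Green–Kubo functional
  set K : ℕ → ℝ → ℝ := fun L s =>
    (∫ x, (∑ i : Fin L, P.bondCurrent L i x) * uc L s x ∂(P.gibbsMeasure L T)) / (T ^ 2 * ((L : ℝ) - 1))
    with hKdef
  have hT2 : 0 < T ^ 2 := by positivity
  -- Abel limits (A3, landed): `K_L(0⁺) = (L−1)·G_L[g]` for EVERY forward field `g`
  have habel_g : ∀ (L : ℕ), 2 ≤ L → ∀ g : PhaseSpace L → ℝ, FF L g →
      Tendsto (K L) (𝓝[>] 0) (𝓝 (GK L g)) := by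
    intro L hL g hg
    have hN1 : 0 < (L : ℝ) - 1 := by
      have : (2 : ℝ) ≤ L := by exact_mod_cast hL
      linarith
    have hden : T ^ 2 * ((L : ℝ) - 1) ≠ 0 := (mul_pos hT2 hN1).ne'
    have h := stub_abelLimit ω₂ lam β γ T ε hω hl hβ hγ hT hε L hL g hg (uc L)
      (fun s hs _ => huc L hL s hs)
    have h' := h.div_const (T ^ 2 * ((L : ℝ) - 1))
    have e : ((L : ℝ) - 1) ^ 2 * (γ * (T ^ 2 - γ * ∫ x, g x * (kin L 0 x - T) ∂(P.gibbsMeasure L T))) /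
        (T ^ 2 * ((L : ℝ) - 1)) = GK L g := by
      simp only [hGK]
      field_simp
    rw [e] at h'
    exact h'
  -- hence the reference sequence
  set D : ℕ → ℝ := fun L => GK L (g0 L) with hDdef
  have habel : ∀ᶠ L in atTop, Tendsto (K L) (𝓝[>] 0) (𝓝 (D L)) := by
    filter_upwards [eventually_ge_atTop 2] with L hL
    exact habel_g L hL (g0 L) (hg0 L hL)
  -- one-sided monotonicity in `s`, uniformly in `L` (M)
  obtain ⟨C₀, hC₀, hMono⟩ := stub_abelMonotone ω₂ lam β γ T ε hω hl hβ hγ hT hε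
  have hmono : ∀ᶠ L in atTop, ∀ s s' : ℝ, 0 < s → s ≤ s' → s' ≤ 1 →
      -(2 * C₀ / T ^ 2 * (s' - s)) ≤ K L s' - K L s := by
    filter_upwards [eventually_ge_atTop 2] with L hL s s' hs hss' _
    have hL2 : (2 : ℝ) ≤ L := by exact_mod_cast hL
    have hN1 : 0 < (L : ℝ) - 1 := by linarith
    have hden : 0 < T ^ 2 * ((L : ℝ) - 1) := mul_pos hT2 hN1
    have hs' : 0 < s' := lt_of_lt_of_le hs hss'
    have hb := hMono L hL s s' hs hss' (uc L s) (uc L s') (huc L hL s hs) (huc L hL s' hs')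
    have hK : K L s' - K L s =
        ((∫ x, (∑ i : Fin L, P.bondCurrent L i x) * uc L s' x ∂(P.gibbsMeasure L T)) -
          ∫ x, (∑ i : Fin L, P.bondCurrent L i x) * uc L s x ∂(P.gibbsMeasure L T)) /
          (T ^ 2 * ((L : ℝ) - 1)) := by
      simp only [hKdef]; ring
    rw [hK, le_div_iff₀ hden]
    have hLL : (L : ℝ) ≤ 2 * ((L : ℝ) - 1) := by linarith
    have hds : 0 ≤ s' - s := by linarith
    calc -(2 * C₀ / T ^ 2 * (s' - s)) * (T ^ 2 * ((L : ℝ) - 1)) = -(C₀ * (2 * ((L : ℝ) - 1)) * (s' - s)) := by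
          field_simp
      _ ≤ -(C₀ * L * (s' - s)) := by
          have : C₀ * L * (s' - s) ≤ C₀ * (2 * ((L : ℝ) - 1)) * (s' - s) :=
            mul_le_mul_of_nonneg_right (mul_le_mul_of_nonneg_left hLL hC₀) hds
          linarith
      _ ≤ (∫ x, (∑ i : Fin L, P.bondCurrent L i x) * uc L s' x ∂(P.gibbsMeasure L T)) -
            ∫ x, (∑ i : Fin L, P.bondCurrent L i x) * uc L s x ∂(P.gibbsMeasure L T) := hb
  -- upper Abel modulus at `0⁺`, uniformly in `L` (U)
  have hupper : ∀ η : ℝ, 0 < η → ∃ s₀ : ℝ, 0 < s₀ ∧ s₀ ≤ 1 ∧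
      ∀ᶠ L in atTop, ∀ s s' : ℝ, 0 < s → s ≤ s' → s' ≤ s₀ → K L s' - K L s ≤ η := by
    intro η hη
    obtain ⟨s₀, hs₀, hs₀1, L₀, hU⟩ :=
      stub_upperAbelModulus ω₂ lam β γ T ε hω hl hβ hγ hT hε (η * T ^ 2) (by positivity)
    refine ⟨s₀, hs₀, hs₀1, ?_⟩
    filter_upwards [eventually_ge_atTop 2, eventually_ge_atTop L₀] with L hL hL₀ s s' hs hss' hs'₀
    have hL2 : (2 : ℝ) ≤ L := by exact_mod_cast hL
    have hN1 : 0 < (L : ℝ) - 1 := by linarith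
    have hden : 0 < T ^ 2 * ((L : ℝ) - 1) := mul_pos hT2 hN1
    have hs' : 0 < s' := lt_of_lt_of_le hs hss'
    have hb := hU L hL₀ hL s s' hs hss' hs'₀ (uc L s) (uc L s') (huc L hL s hs) (huc L hL s' hs')
    have hK : K L s' - K L s =
        ((∫ x, (∑ i : Fin L, P.bondCurrent L i x) * uc L s' x ∂(P.gibbsMeasure L T)) -
          ∫ x, (∑ i : Fin L, P.bondCurrent L i x) * uc L s x ∂(P.gibbsMeasure L T)) /
          (T ^ 2 * ((L : ℝ) - 1)) := by
      simp only [hKdef]; ring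
    rw [hK, div_le_iff₀ hden]
    calc (∫ x, (∑ i : Fin L, P.bondCurrent L i x) * uc L s' x ∂(P.gibbsMeasure L T)) -
            ∫ x, (∑ i : Fin L, P.bondCurrent L i x) * uc L s x ∂(P.gibbsMeasure L T)
          ≤ η * T ^ 2 * ((L : ℝ) - 1) := hb
      _ = η * (T ^ 2 * ((L : ℝ) - 1)) := by ring
  -- thermodynamic limit at fixed s (A4)
  have htl : ∀ s : ℝ, 0 < s → s ≤ 1 → ∃ Λ : ℝ, Tendsto (fun L => K L s) atTop (𝓝 Λ) := by
    intro s hs hs1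
    obtain ⟨Kinf, hKinf⟩ := stub_fixedAbelThermodynamicLimit ω₂ lam β γ T ε hω hl hβ hγ hT hε s hs hs1
      (fun L => uc L s) (fun L hL => huc L hL s hs)
    refine ⟨Kinf / T ^ 2, ?_⟩
    have hfun : (fun L => K L s) = fun L : ℕ =>
        ((∫ x, (∑ i : Fin L, P.bondCurrent L i x) * uc L s x ∂(P.gibbsMeasure L T)) / ((L : ℝ) - 1)) / T ^ 2 := by
      funext L
      simp only [hKdef]
      rw [mul_comm, div_mul_eq_div_div]
    rw [hfun]
    exact hKinf.div_const _
  -- floor (A7)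
  obtain ⟨c, hc, L₀, hfl⟩ := stub_thomsonFloor ω₂ lam β γ T ε hω hl hβ hγ hT hε
  have hfloor : ∀ᶠ L in atTop, ∀ s : ℝ, 0 < s → s ≤ 1 → c / T ^ 2 ≤ K L s := by
    filter_upwards [eventually_ge_atTop 2, eventually_ge_atTop L₀] with L hL hL₀ s hs hs1
    have hN1 : 0 < (L : ℝ) - 1 := by
      have : (2 : ℝ) ≤ L := by exact_mod_cast hL
      linarith
    have hden : 0 < T ^ 2 * ((L : ℝ) - 1) := mul_pos hT2 hN1
    have hb := hfl L hL₀ hL s hs hs1 (uc L s) (huc L hL s hs)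
    simp only [hKdef]
    rw [le_div_iff₀ hden]
    calc c / T ^ 2 * (T ^ 2 * ((L : ℝ) - 1)) = c * ((L : ℝ) - 1) := by field_simp
      _ ≤ ∫ x, (∑ i : Fin L, P.bondCurrent L i x) * uc L s x ∂(P.gibbsMeasure L T) := hb
  obtain ⟨κ, hκ, hconv⟩ :=
    abel_mooreOsgood_oneSided K D (2 * C₀ / T ^ 2) (c / T ^ 2) (by positivity) hmono hupper habel htl hfloor
  refine ⟨κ, hκ, fun g hg => ?_⟩
  -- the Kubo sequence of an arbitrary forward-field family IS the reference sequence (uniqueness of Abel limits)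
  have heq : ∀ᶠ L in atTop, GK L (g L) = D L := by
    filter_upwards [eventually_ge_atTop 2] with L hL
    haveI : (𝓝[>] (0 : ℝ)).NeBot := nhdsGT_neBot 0
    exact tendsto_nhds_unique (habel_g L hL (g L) (hg L hL)) (habel_g L hL (g0 L) (hg0 L hL))
  exact hconv.congr' (heq.mono fun L hL => hL.symm)

/-- **The skeleton concludes the crux BY NAME**: `VanishingNoiseTransfer.NoisyFourier` (stmt-AtomisticToContinuum-11977)
from the registered stubs through `kuboLimit_of_parts` and the landed closer `noisyFourier_of_kuboLimit` (c3). -/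
theorem NoisyFourier_of : NoisyFourier :=
  Summit.AtomisticToContinuum.FouriersLaw.Theorems.NoisyFourier.LineAssembly.noisyFourier_of_kuboLimit
    kuboLimit_of_parts

end Summit.AtomisticToContinuum.FouriersLaw.Cruxes.NoisyFourier.AbelKapitzaEvenCorrector

end
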